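import Summits.KontsevichZagierPeriods.KontsevichZagierPeriods.Theorems.OctahedralSymmetryOctahedralSpanAllWeightsDefs
import Summits.KontsevichZagierPeriods.KontsevichZagierPeriods.Theorems.OctahedralSymmetryOctahedralSpanAllWeightsStubElimGt
import Summits.KontsevichZagierPeriods.KontsevichZagierPeriods.Theorems.OctahedralSymmetryOctahedralSpanAllWeightsStubWeightTwo
import Summits.KontsevichZagierPeriods.KontsevichZagierPeriods.Theorems.OctahedralSymmetryOctahedralSpanAllWeightsStubElimEndGlue
import Summits.KontsevichZagierPeriods.KontsevichZagierPeriods.Theorems.OctahedralSymmetryOctahedralSpanAllWeightsStubWeightThree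
import Summits.KontsevichZagierPeriods.KontsevichZagierPeriods.Theorems.OctahedralSymmetryOctahedralSpanAllWeightsStubRegularE0DepthTwo
import Summits.KontsevichZagierPeriods.KontsevichZagierPeriods.Theorems.OctahedralSymmetryOctahedralSpanAllWeightsStubRegularUnitLayerOne
import Summits.KontsevichZagierPeriods.KontsevichZagierPeriods.Theorems.OctahedralSymmetryOctahedralSpanAllWeightsStubRegularUnitManyTwos
import Summits.KontsevichZagierPeriods.KontsevichZagierPeriods.Theorems.OctahedralSymmetryOctahedralSpanAllWeightsLowWeights
import Summits.KontsevichZagierPeriods.KontsevichZagierPeriods.Theorems.OctahedralSymmetryOctahedralSpanAllWeightsStubElimLevelOne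
import Summits.KontsevichZagierPeriods.KontsevichZagierPeriods.Theorems.OctahedralSymmetryOctahedralSpanAllWeightsStubElimLexGlue
import Summits.KontsevichZagierPeriods.KontsevichZagierPeriods.Theorems.OctahedralSymmetryOctahedralSpanAllWeightsStubElimEndAlpha
import Mathlib.LinearAlgebra.Span.Basic
import HarnessLib

/-!
# Crux `OctahedralSpanAllWeights` (stmt-KontsevichZagierPeriods-9659) — line `Sketch`: SKELETON (v6, lead c3)

Lead prover's skeleton (crux protocol, MODE LINE). The crux item is informal; its typed form
`OctaSpan.OctahedralSpanAllWeights` ("corank ≤ 2^w for every weight") and the formal-span vocabulary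
are the route Defs file `Theorems/OctahedralSymmetryOctahedralSpanAllWeightsDefs.lean` (p102163, landed).

Line `Sketch` = the unit-pole filtration of card `unit-pole-elimination` (ideator 1): filter convergent
words by the number of letters `0` (the pole `1`), then `e₁`-free words by the number of letters `4`
(the pole `0`), then unit words by the number of letters `2` (the pole `−1`).
* E1 (`#0 > #4`, one involution generator, all weights): LANDED, `stub_elim_gt` (p104636).
* E2 (`1 ≤ #0 ≤ #4`): reduced (all weights, LANDED p109482 `ElimEnd.elim_of_gt_of_end`) to its END CASE
  `stub_elim_end` — words ending in the letter `0`, given E at smaller lengths (open core; exact-rank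
  evidence: all layers for `w ≤ 6`, layer `#0 = 1` for `w = 7`).
* F1 (`e₁`-free, lower `#4`): depth-one and depth-two layers (all weights), front reduction and glue
  LANDED (F1 worker, `RegularE0.*`); open core `stub_regular_e0_core` = 4-initial words of depth `≥ 3`
  given F1 for shorter words (true for lengths `≤ 5` by exact rank; not triangular from length 4 on).
* F2 (unit words, lower `#2`): front reduction, top layer `2^n`, the layer with one letter `≠ 2` (all
  lengths `≥ 3`, internal generators only) and glue LANDED (lead -0, `RegularUnit.*`); NEW (lead c1, v5):
  the σ-inclusion–exclusion `unit_manyTwos` (all lengths): every unit word with MORE letters `2` than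
  other letters reduces, by an alternating sum of involution generators of lower words; open core
  `stub_regular_unit_core` = 2-initial unit words with `≥ 2` letters `≠ 2` AND AT MOST HALF of the letters
  equal to `2`, given F2 for shorter words (needs finite double shuffles; its bottom layer `#2 = 1` needs
  all four families in the lab).
* Calibration LANDED: `SpanBound w` for `w ≤ 3` by kernel-checked certificate tables (`stub_weight_two`
  p105211, 12 certificates; `stub_weight_three` p109703, 72 certificates).
* Composition (proved here): E1 ∧ E2-glue ∧ `stub_elim_end` give `elim_unitPole`; the cores with their
  glues give the one-step blocks F1, F2 and `regular` (double induction); strong induction on `#0` gives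
  `TwoLetterNormalForm w` for every `w`, hence `SpanBound w` (`#twoWords w ≤ 2^w`), hence the crux.
  Each core is a CONSEQUENCE of `TwoLetterNormalForm` at its own length (two-letter words lie in every
  lower span), so the decomposition is faithful: cores ⟺ crux-strength, true for lengths `≤ 6`.
-/

noncomputable section

namespace Summit.KontsevichZagierPeriods.OctahedralSymmetry.OctaSpan

open Literature.NumberTheory.Transcendental Literature.NumberTheory.Transcendental.LevelFour

/-! ## Part B. The stubs of line `Sketch` -/

/-! ### Block E (letters `0`, the pole `1`), reshaped by lead c3 (skeleton v6)

The E block is now proved modulo the LEXICOGRAPHIC target: a convergent word with a letter `0` reduces,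
modulo `rel`, to convergent words of the same length with fewer letters `0`, OR with the same number of
letters `0` and fewer letters `4` (lab, lead c3: with this order single generators peel every word of
length `≤ 6` in at most five rounds; with "fewer `0`" alone the greedy peeling needs 24 rounds at
length 5).  The outer induction of Part C becomes lexicographic in `(#0, #4)`.  New all-weights layers:
`stub_elim_levelOne` (level-one words, one distribution generator; LANDED p147535) and `stub_elim_end_alpha` (words
`Z 0 4^k 0` with a unit letter missing from `Z`, one finite double shuffle with a weight-one factor; LANDED p147969);
the glue `stub_elim_lex_glue` (LANDED p147536) is `ElimEnd.elim_of_gt_of_end` re-targeted; the open core is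
`stub_elim_end_lex` (lengths `≥ 5`, a unit letter present, not of shape alpha).  Also landed in this cycle: `elim_afree`
(…StubElimAfree p149103: `4`-free words are `0`-free modulo `rel`), and for block F1 the worker files …RegularE0InteriorTricolour
(p149049: `RegularE0.twoHeaded`, `RegularE0.interiorTricolour`) and …RegularE0ConjugationFamily (p149078: `RegularE0.relK`) — sub-layers /
a relation family of the depth-3 part of `stub_regular_e0_core`, whose signature is left unchanged (see Cruxes/…/NOTES.md §−1). -/

/-- **Stub E-core (the open core of block E, reshaped; lead).** A convergent word of length `≥ 5` ENDING
in the letter `0`, with `#0 ≤ #4`, containing a unit letter, and not of the shape alpha (`Z 0 4^k 0` with a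
unit letter missing from `Z`), reduces modulo `rel` to convergent words of the same length with fewer
letters `0` or with as many letters `0` and fewer letters `4` — given that every SHORTER convergent word
with a letter `0` so reduces.  Open for general lengths (lab: every such word of length `≤ 6` peels by
single generators in at most five rounds for this order). [cite: Zhao2010, §2] -/
theorem stub_elim_end_lex (W : List (Fin 5))
    (hlow : ∀ V : List (Fin 5), V.length < W.length → IsConvergent V → 0 < V.count 0 →
      sym V ∈ rel ⊔ Submodule.span ℚ (sym '' {V' | V'.length = V.length ∧ IsConvergent V' ∧
        (V'.count 0 < V.count 0 ∨ (V'.count 0 = V.count 0 ∧ V'.count 4 < V.count 4))}))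
    (hW : IsConvergent W) (hlast : W.getLast? = some 0) (h2 : W.count 0 ≤ W.count 4)
    (hlen : 5 ≤ W.length) (hunit : ∃ a ∈ W, a = 1 ∨ a = 2 ∨ a = 3)
    (hnα : ∀ (Z : List (Fin 5)) (k : ℕ), 1 ≤ k → W = Z ++ 0 :: (List.replicate k 4 ++ [0]) →
      ∀ u : Fin 5, (u = 1 ∨ u = 2 ∨ u = 3) → u ∈ Z) :
    sym W ∈ rel ⊔ Submodule.span ℚ (sym '' {V | V.length = W.length ∧ IsConvergent V ∧
      (V.count 0 < W.count 0 ∨ (V.count 0 = W.count 0 ∧ V.count 4 < W.count 4))}) := by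
  sorry

/-- **Stub F1-core (the open core of block F1).** An `e₁`-free convergent word of length `n` that
BEGINS with the letter `4` (pole `0`) and has depth `≥ 3` (at least three letters other than `4` … i.e.
`#4 + 3 ≤ n`) reduces, modulo `rel`, to `e₁`-free convergent words of the same length with fewer letters
`4` — given block F1 for all shorter words. With the landed depth-one and depth-two layers, the front
reduction and the glue `RegularE0.regular_e0_of_core` (F1 worker) this is all of block F1. Open in general
(true for `n ≤ 5` by exact rank; not triangular from `n = 4` on). [cite: Zhao2010, §2] -/
theorem stub_regular_e0_core (n : ℕ)
    (hlow : ∀ W : List (Fin 5), W.length < n → IsConvergent W → W.count 0 = 0 → 0 < W.count 4 →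
      sym W ∈ rel ⊔ RegularE0.e0Lower W)
    (W : List (Fin 5)) (hn : W.length = n) (hhead : W.head? = some 4) (hW : IsConvergent W)
    (h0 : W.count 0 = 0) (hdepth : W.count 4 + 3 ≤ W.length) :
    sym W ∈ rel ⊔ RegularE0.e0Lower W := by
  sorry

/-- **Stub F2-core (the open core of block F2).** A 2-INITIAL unit word (letters `1, 2, 3`, first
letter `2`) with at least two letters other than `2` and AT MOST HALF of its letters equal to `2` (the
majority case being `unit_manyTwos`, landed) reduces, modulo `rel`, to unit words of the same length
with fewer letters `2` — given block F2 for all shorter unit words. With the landed front reduction, top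
layer, one-letter layer (`RegularUnit.unitLayerOne`, all lengths `≥ 3`) and glue
`RegularUnit.regular_unit_of_core` (lead) this is all of block F2. Open in general (true for lengths `≤ 4`
by exact rank; the internal generators — seed lifts and involution — do NOT suffice here: finite double
shuffles, whose merged terms leave the unit alphabet, are needed). [cite: Zhao2008, §4] -/
theorem stub_regular_unit_core (W : List (Fin 5))
    (hlow : ∀ V : List (Fin 5), V.length < W.length → (∀ a ∈ V, a = 1 ∨ a = 2 ∨ a = 3) → 0 < V.count 2 →
      sym V ∈ rel ⊔ Submodule.span ℚ (sym '' {V' | V'.length = V.length ∧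
        (∀ a ∈ V', a = 1 ∨ a = 2 ∨ a = 3) ∧ V'.count 2 < V.count 2}))
    (hU : ∀ a ∈ W, a = 1 ∨ a = 2 ∨ a = 3) (hhead : W.head? = some 2) (hk : W.count 2 + 2 ≤ W.length)
    (hfew : 2 * W.count 2 ≤ W.length) :
    sym W ∈ rel ⊔ Submodule.span ℚ (sym '' {V | V.length = W.length ∧
      (∀ a ∈ V, a = 1 ∨ a = 2 ∨ a = 3) ∧ V.count 2 < W.count 2}) := by
  sorry

/-! ## Part C. Composition (sorry-free): E1 ∧ E2 ∧ F ⟹ normal form in every weight ⟹ the crux -/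

/-- **Block F1 (one step) from its core and the landed F1 glue.** [folklore] -/
theorem regular_e0_step (W : List (Fin 5)) (hW : IsConvergent W) (h0 : W.count 0 = 0) (h4 : 0 < W.count 4) :
    sym W ∈ rel ⊔ Submodule.span ℚ (sym '' {V | V.length = W.length ∧ IsConvergent V ∧
      V.count 0 = 0 ∧ V.count 4 < W.count 4}) :=
  RegularE0.regular_e0_of_core stub_regular_e0_core W hW h0 h4

/-- **Block F2 (one step) from its core, the σ-inclusion–exclusion (majority of letters `2`) and the
landed F2 glue.** [folklore] -/
theorem regular_unit_step (W : List (Fin 5)) (hU : ∀ a ∈ W, a = 1 ∨ a = 2 ∨ a = 3) (h2 : 0 < W.count 2) :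
    sym W ∈ rel ⊔ Submodule.span ℚ (sym '' {V | V.length = W.length ∧
      (∀ a ∈ V, a = 1 ∨ a = 2 ∨ a = 3) ∧ V.count 2 < W.count 2}) :=
  RegularUnit.regular_unit_of_core (fun W hlow hU hhead hk =>
    if hmaj : W.length < 2 * W.count 2 then unit_manyTwos W hU hmaj
    else stub_regular_unit_core W hlow hU hhead hk (Nat.le_of_not_lt hmaj)) W hU h2


/-- A unit word (letters `1, 2, 3`) is convergent and has no letters `0`, `4`. [folklore] -/
theorem isConvergent_of_unit (W : List (Fin 5)) (hU : ∀ a ∈ W, a = 1 ∨ a = 2 ∨ a = 3) :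
    IsConvergent W ∧ W.count 0 = 0 ∧ W.count 4 = 0 := by
  refine ⟨⟨?_, ?_⟩, ?_, ?_⟩
  · intro h
    have hm : (0 : Fin 5) ∈ W := List.mem_of_mem_head? h
    rcases hU 0 hm with h0 | h0 | h0 <;> exact absurd h0 (by decide)
  · intro h
    have hm : (4 : Fin 5) ∈ W := List.mem_of_mem_getLast? h
    rcases hU 4 hm with h4 | h4 | h4 <;> exact absurd h4 (by decide)
  · exact List.count_eq_zero.2 fun hm => by rcases hU 0 hm with h | h | h <;> exact absurd h (by decide)
  · exact List.count_eq_zero.2 fun hm => by rcases hU 4 hm with h | h | h <;> exact absurd h (by decide)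

/-- A word with no letters `0` and `4` is a unit word. [folklore] -/
theorem unit_of_count (W : List (Fin 5)) (h0 : W.count 0 = 0) (h4 : W.count 4 = 0) :
    ∀ a ∈ W, a = 1 ∨ a = 2 ∨ a = 3 := by
  intro a ha
  have h0' : a ≠ 0 := fun h => (List.count_eq_zero.1 h0) (h ▸ ha)
  have h4' : a ≠ 4 := fun h => (List.count_eq_zero.1 h4) (h ▸ ha)
  fin_cases a <;> simp_all

/-- A unit word without the letter `2` is a two-letter word. [folklore] -/
theorem mem_twoWords_of_unit (W : List (Fin 5)) (hU : ∀ a ∈ W, a = 1 ∨ a = 2 ∨ a = 3)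
    (h2 : W.count 2 = 0) : W ∈ twoWords W.length := by
  refine (mem_twoWords_iff _ _).2 ⟨rfl, fun a ha => ?_⟩
  rcases hU a ha with h | h | h
  · exact Or.inl h
  · exact absurd (h ▸ ha) (List.count_eq_zero.1 h2)
  · exact Or.inr h

/-- **F2 iterated**: every unit word reduces to two-letter words (strong induction on `#2`). [folklore] -/
theorem regular_unit (W : List (Fin 5)) (hU : ∀ a ∈ W, a = 1 ∨ a = 2 ∨ a = 3) :
    sym W ∈ rel ⊔ twoSpan W.length := by
  suffices key : ∀ n : ℕ, ∀ W : List (Fin 5), W.count 2 = n → (∀ a ∈ W, a = 1 ∨ a = 2 ∨ a = 3) →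
      sym W ∈ rel ⊔ twoSpan W.length from key _ W rfl hU
  intro n
  induction n using Nat.strong_induction_on with
  | _ n ih =>
    intro W hn hU
    rcases Nat.eq_zero_or_pos n with rfl | hpos
    · exact Submodule.mem_sup_right (Submodule.subset_span ⟨W, mem_twoWords_of_unit W hU hn, rfl⟩)
    · have hmem := regular_unit_step W hU (hn ▸ hpos)
      have hle : rel ⊔ Submodule.span ℚ (sym '' {V | V.length = W.length ∧
          (∀ a ∈ V, a = 1 ∨ a = 2 ∨ a = 3) ∧ V.count 2 < W.count 2}) ≤ rel ⊔ twoSpan W.length := by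
        refine sup_le le_sup_left (Submodule.span_le.mpr ?_)
        rintro _ ⟨V, ⟨hVlen, hVU, hVlt⟩, rfl⟩
        have := ih (V.count 2) (hn ▸ hVlt) V rfl hVU
        rwa [hVlen] at this
      exact hle hmem

/-- **F = F1 ∧ F2 iterated (endpoint-regular completeness)**: an `e₁`-free convergent word reduces to
two-letter words (strong induction on `#4`, then `regular_unit`). [folklore] -/
theorem regular (W : List (Fin 5)) (hW : IsConvergent W) (h0 : W.count 0 = 0) :
    sym W ∈ rel ⊔ twoSpan W.length := by
  suffices key : ∀ n : ℕ, ∀ W : List (Fin 5), W.count 4 = n → IsConvergent W → W.count 0 = 0 →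
      sym W ∈ rel ⊔ twoSpan W.length from key _ W rfl hW h0
  intro n
  induction n using Nat.strong_induction_on with
  | _ n ih =>
    intro W hn hW h0
    rcases Nat.eq_zero_or_pos n with rfl | hpos
    · exact regular_unit W (unit_of_count W h0 hn)
    · have hmem := regular_e0_step W hW h0 (hn ▸ hpos)
      have hle : rel ⊔ Submodule.span ℚ (sym '' {V | V.length = W.length ∧ IsConvergent V ∧
          V.count 0 = 0 ∧ V.count 4 < W.count 4}) ≤ rel ⊔ twoSpan W.length := by
        refine sup_le le_sup_left (Submodule.span_le.mpr ?_)
        rintro _ ⟨V, ⟨hVlen, hVconv, hV0, hVlt⟩, rfl⟩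
        have := ih (V.count 4) (hn ▸ hVlt) V rfl hVconv hV0
        rwa [hVlen] at this
      exact hle hmem

/-- A two-letter word (letters `1`, `3`) of length `w` is convergent and has no letter `0`. [folklore] -/
theorem twoWords_conv {w : ℕ} {V : List (Fin 5)} (hV : V ∈ twoWords w) :
    V.length = w ∧ IsConvergent V ∧ V.count 0 = 0 ∧ V.count 4 = 0 := by
  obtain ⟨hlen, h13⟩ := (mem_twoWords_iff w V).1 hV
  have hU : ∀ a ∈ V, a = 1 ∨ a = 2 ∨ a = 3 := fun a ha => by
    rcases h13 a ha with h | h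
    · exact Or.inl h
    · exact Or.inr (Or.inr h)
  exact ⟨hlen, isConvergent_of_unit V hU⟩

/-- `lowerSpan W` (fewer letters `0`) lies in the lexicographic span. [folklore] -/
theorem lowerSpan_le_lex (W : List (Fin 5)) : lowerSpan W ≤ Submodule.span ℚ (sym '' {V | V.length = W.length ∧ IsConvergent V ∧
      (V.count 0 < W.count 0 ∨ (V.count 0 = W.count 0 ∧ V.count 4 < W.count 4))}) :=
  Submodule.span_mono (Set.image_mono fun _ ⟨h1, h2, h3⟩ => ⟨h1, h2, Or.inl h3⟩)

/-- `twoSpan |W|` lies in the lexicographic span of a word `W` containing the letter `0`. [folklore] -/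
theorem twoSpan_le_lex (W : List (Fin 5)) (h0 : 0 < W.count 0) : twoSpan W.length ≤ Submodule.span ℚ (sym '' {V | V.length = W.length ∧ IsConvergent V ∧
      (V.count 0 < W.count 0 ∨ (V.count 0 = W.count 0 ∧ V.count 4 < W.count 4))}) := by
  refine Submodule.span_mono (Set.image_mono fun V hV => ?_)
  obtain ⟨hlen, hconv, hV0, -⟩ := twoWords_conv (Finset.mem_coe.1 hV)
  exact ⟨hlen, hconv, Or.inl (hV0 ▸ h0)⟩

/-- **The end case, dispatched**: low lengths by the landed normal form in weights `≤ 4`, level-one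
words by `stub_elim_levelOne`, shape alpha by `stub_elim_end_alpha`, the rest by the core. [folklore] -/
theorem elim_end_dispatch (W : List (Fin 5))
    (hlow : ∀ V : List (Fin 5), V.length < W.length → IsConvergent V → 0 < V.count 0 →
      sym V ∈ rel ⊔ Submodule.span ℚ (sym '' {V' | V'.length = V.length ∧ IsConvergent V' ∧
        (V'.count 0 < V.count 0 ∨ (V'.count 0 = V.count 0 ∧ V'.count 4 < V.count 4))}))
    (hW : IsConvergent W) (hlast : W.getLast? = some 0) (h2 : W.count 0 ≤ W.count 4) :
    sym W ∈ rel ⊔ Submodule.span ℚ (sym '' {V | V.length = W.length ∧ IsConvergent V ∧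
      (V.count 0 < W.count 0 ∨ (V.count 0 = W.count 0 ∧ V.count 4 < W.count 4))}) := by
  have h0 : 0 < W.count 0 := List.count_pos_iff.2 (List.mem_of_mem_getLast? hlast)
  by_cases hlen : W.length ≤ 4
  · exact (sup_le_sup_left (twoSpan_le_lex W h0) _)
      (twoLetterNormalForm_of_le_four W.length hlen W rfl hW)
  by_cases hab : ∀ a ∈ W, a = 0 ∨ a = 4
  · exact (sup_le_sup_left (lowerSpan_le_lex W) _)
      (stub_elim_levelOne W hW hab h0 (h0.trans_le h2))
  by_cases hα : ∃ (Z : List (Fin 5)) (k : ℕ), 1 ≤ k ∧ W = Z ++ 0 :: (List.replicate k 4 ++ [0]) ∧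
      ∃ u : Fin 5, (u = 1 ∨ u = 2 ∨ u = 3) ∧ u ∉ Z
  · obtain ⟨Z, k, hk, rfl, u, hu, huZ⟩ := hα
    exact stub_elim_end_alpha Z k hk u hu huZ hW
  · push Not at hab hα
    obtain ⟨a, haW, ha0, ha4⟩ := hab
    refine stub_elim_end_lex W hlow hW hlast h2 (by omega) ⟨a, haW, ?_⟩ ?_
    · fin_cases a <;> simp_all
    · intro Z k hk hWZ u hu
      exact hα Z k hk hWZ u hu

/-- **Block E (all of it) from E1 (landed), the lexicographic glue and the dispatched end case**: every
convergent word containing the letter `0` reduces lexicographically. [folklore] -/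
theorem elim_unitPole (W : List (Fin 5)) (hW : IsConvergent W) (h : 0 < W.count 0) :
    sym W ∈ rel ⊔ Submodule.span ℚ (sym '' {V | V.length = W.length ∧ IsConvergent V ∧
      (V.count 0 < W.count 0 ∨ (V.count 0 = W.count 0 ∧ V.count 4 < W.count 4))}) :=
  stub_elim_lex_glue stub_elim_gt (fun W hlow hW hlast h2 => elim_end_dispatch W hlow hW hlast h2) W hW h

/-- **The two-letter normal form in every weight** (lexicographic induction on `(#0, #4)`:
`elim_unitPole` lowers the pair, `regular` finishes at `#0 = 0`). [folklore] -/
theorem twoLetterNormalForm_all (w : ℕ) : TwoLetterNormalForm w := by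
  suffices key : ∀ c d : ℕ, ∀ W : List (Fin 5), W.count 0 = c → W.count 4 = d → W.length = w →
      IsConvergent W → sym W ∈ rel ⊔ twoSpan w from
    fun W hlen hW => key _ _ W rfl rfl hlen hW
  intro c
  induction c using Nat.strong_induction_on with
  | _ c ihc =>
    intro d
    induction d using Nat.strong_induction_on with
    | _ d ihd =>
      intro W hc hd hlen hW
      rcases Nat.eq_zero_or_pos c with rfl | hpos
      · exact hlen ▸ regular W hW hc
      · have hmem := elim_unitPole W hW (hc ▸ hpos)
        have hle : rel ⊔ Submodule.span ℚ (sym '' {V | V.length = W.length ∧ IsConvergent V ∧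
      (V.count 0 < W.count 0 ∨ (V.count 0 = W.count 0 ∧ V.count 4 < W.count 4))}) ≤ rel ⊔ twoSpan w := by
          refine sup_le le_sup_left (Submodule.span_le.mpr ?_)
          rintro _ ⟨V, ⟨hVlen, hVconv, hlt⟩, rfl⟩
          rcases hlt with hlt | ⟨heq, hlt4⟩
          · exact ihc (V.count 0) (hc ▸ hlt) (V.count 4) V rfl rfl (hVlen.trans hlen) hVconv
          · exact ihd (V.count 4) (hd ▸ hlt4) V (heq.trans hc) rfl (hVlen.trans hlen) hVconv
        exact hle hmem

/-- **The crux from the stubs**: `SpanBound w` for every `w` with `S = twoWords w`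
(`#twoWords w ≤ 2^w`). [folklore] -/
theorem OctahedralSpanAllWeights_of : OctahedralSpanAllWeights := fun w =>
  spanBound_of_twoLetterNormalForm (twoLetterNormalForm_all w)

/-- **The crux from the stubs** (name expected by the skeleton checker; the crux item is informal, its
typed form is `OctaSpan.OctahedralSpanAllWeights`, Defs p102163). [folklore] -/
theorem OctahedralSpanAllWeights_proof : OctahedralSpanAllWeights := OctahedralSpanAllWeights_of

end Summit.KontsevichZagierPeriods.OctahedralSymmetry.OctaSpan

end
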